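import Summits.KontsevichZagierPeriods.KontsevichZagierPeriods.Theses.HardSphereVirial
import Summits.KontsevichZagierPeriods.KontsevichZagierPeriods.Theorems.InverseLandauTateLiftingIsotropySpace
import Summits.KontsevichZagierPeriods.KontsevichZagierPeriods.Theorems.InverseLandauTateLiftingIsotropyPlane

/-!
Crux-strategist verification (cstrat stmt-KontsevichZagierPeriods-10457):
the crux `HardSphereVirial.IsotropyFactorisation3` (stmt-10457) and the support item
`HardSphereVirial.IsotropyFactorisation2` (stmt-10458) are LANDED THEOREMS of the tree
(`Summit.KontsevichZagierPeriods.InverseLandau.tateLifting_isotropySpaceMove`,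
`Summit.KontsevichZagierPeriods.InverseLandau.tateLifting_isotropyPlane`), by `exact`.
-/

namespace Summit.KontsevichZagierPeriods.KontsevichZagierPeriods.Theses.HardSphereVirial

theorem isotropyFactorisation3_proved : IsotropyFactorisation3 :=
  Summit.KontsevichZagierPeriods.InverseLandau.tateLifting_isotropySpaceMove

theorem isotropyFactorisation2_proved : IsotropyFactorisation2 :=
  Summit.KontsevichZagierPeriods.InverseLandau.tateLifting_isotropyPlane

end Summit.KontsevichZagierPeriods.KontsevichZagierPeriods.Theses.HardSphereVirial
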